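import Literature.Geometry.Symplectic.PencilEndLeafCoords
import Literature.Geometry.Symplectic.PencilEndInterceptIFT
import HarnessLib

/-!
# The intercept chart of the local family of leaves of the blown-up end

Support file (no new facts, D-0026) for the glue
`jPlanePencil_localFamily_homotopySphere ⟸ hls_localFoliation_embeddedSphere_trivialNormal`
(C. Wendl, *Holomorphic Curves in Low Dimensions* (2018), proof of Prop. 2.53, p. 65).

`PencilEnd.exists_interceptChart`. Let `G : PencilEnd p` be the blown-up end at `p` with its
almost complex structure `JY` (`PencilEndAlmostComplex.lean`), `u₀` a member of Gromov's pencil of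
intercept `b₀` (`‖b₀ - G.b₀‖ < ρ'`), and `(U a, V a)`, `‖a‖ < ε`, a jointly smooth family of
`JY`-holomorphic two-chart spheres of `Y` with jointly immersive evaluation maps through the
compactified member `(memberU u₀, memberV u₀ b₀)` at `a = 0` (the existence half of the HLS fact
`hls_localFoliation_embeddedSphere_trivialNormal` applied in `Y`). Then, near `a = 0`: a `V`-disc
`‖w‖ < r₂` lies in the box chart `range inB`, where `w ↦ boxCoord (V a w)` is holomorphic
(`JY = i` there, `differentiableOn_boxCoord_comp`); its `x'`-component has exactly one zero `wz a`
on `‖w‖ ≤ r₂`, simple (inverse function theorem, `InterceptChart.exists_localDiffeo`, fed with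
`x'(memberV u₀ b₀ w) = capX w`, `capX' (0) = 1`), i.e. the leaf meets the exceptional disc `E` once
on that disc and not on the complementary `U`-disc `‖z‖ ≤ r₂⁻¹`; the intercept
`β a = w(V a (wz a))` of the leaf is a local diffeomorphism at `0` with local inverse `α` on
`ball b₀ δ`. This is the Literature-side analogue of the summit-side `stub_interceptChart`
(`Summits/SmoothPoincare4/…/SullivanDualWitnessChargeV15InterceptChart.lean`, cap model of a
homotopy 4-sphere), for the blown-up end `G.Y` of an arbitrary `4`-manifold germ.

## References

* C. Wendl, *Holomorphic Curves in Low Dimensions*, LNM 2216 (2018), proof of Prop. 2.53. [Wendl2018]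
-/

noncomputable section

open scoped Manifold ContDiff Topology
open Set Function Filter Metric Complex Literature.Topology.FourManifolds

namespace Literature.Geometry.Symplectic

namespace PencilEnd

variable {M : Type} [TopologicalSpace M] [ChartedSpace (EuclideanSpace ℝ (Fin 4)) M] [T2Space M]
  [CompactSpace M] [IsManifold (𝓡 4) ∞ M] {p : M} (G : PencilEnd p)
  (J : ∀ x : punctured p, TangentSpace (𝓡 4) x →L[ℝ] TangentSpace (𝓡 4) x)

/-- Injective linear endomorphisms of `ℂ × ℂ` (over `ℝ`) are bijective. [folklore] -/
theorem bijective_of_injective_real {L : (ℂ × ℂ) →L[ℝ] ℂ × ℂ} (h : Injective L) : Bijective L :=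
  ⟨h, (LinearMap.injective_iff_surjective (f := (L : (ℂ × ℂ) →ₗ[ℝ] ℂ × ℂ))).1 h⟩

/-- **The intercept chart of the local family of leaves** (see the module docstring).
[cite: Wendl2018, proof of Prop. 2.53 (p. 65)] -/
theorem exists_interceptChart
    (hJstd : ∀ x : punctured p, InPuncturedChartBall p G.rad x →
      ∀ (v : TangentSpace (𝓡 4) x) (c : EuclideanSpace ℝ (Fin 4)),
        inner ℝ (fderiv ℝ inversion (extChartAt (𝓡 4) p x.1 - extChartAt (𝓡 4) p p)
          (mfderiv (𝓡 4) 𝓘(ℝ, EuclideanSpace ℝ (Fin 4))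
            (fun z : punctured p => extChartAt (𝓡 4) p z.1) x (J x v))) c
        = stdSymplecticForm (fderiv ℝ inversion (extChartAt (𝓡 4) p x.1 - extChartAt (𝓡 4) p p)
          (mfderiv (𝓡 4) 𝓘(ℝ, EuclideanSpace ℝ (Fin 4))
            (fun z : punctured p => extChartAt (𝓡 4) p z.1) x v)) c)
    {u₀ : ℂ → punctured p} {b₀ : ℂ} (hu₀ : IsPencilPlane J u₀ b₀) (hb₀ : ‖b₀ - G.b₀‖ < G.ρ')
    {ε : ℝ} {U V : ℂ → ℂ → G.Y} (hε : 0 < ε)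
    (hU0 : ∀ z, U 0 z = G.memberU u₀ z) (hV0 : ∀ w, V 0 w = G.memberV u₀ b₀ w)
    (hUV : ∀ a : ℂ, ‖a‖ < ε →
      (∀ z : ℂ, z ≠ 0 → V a z = U a z⁻¹) ∧
      IsJHolomorphic (𝓡 4) (fun y => G.JY J y) (U a) ∧ IsJHolomorphic (𝓡 4) (fun y => G.JY J y) (V a))
    (hUfam : ContMDiffOn 𝓘(ℝ, ℂ × ℂ) (𝓡 4) ∞ (fun q : ℂ × ℂ => U q.1 q.2) (ball 0 ε ×ˢ univ))
    (hVfam : ContMDiffOn 𝓘(ℝ, ℂ × ℂ) (𝓡 4) ∞ (fun q : ℂ × ℂ => V q.1 q.2) (ball 0 ε ×ˢ univ))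
    (hinj : ∀ q ∈ ball (0 : ℂ) ε ×ˢ (univ : Set ℂ),
      Injective (mfderiv 𝓘(ℝ, ℂ × ℂ) (𝓡 4) (fun q : ℂ × ℂ => U q.1 q.2) q) ∧
      Injective (mfderiv 𝓘(ℝ, ℂ × ℂ) (𝓡 4) (fun q : ℂ × ℂ => V q.1 q.2) q)) :
    ∃ (ε₁ r₁ r₂ δ : ℝ) (wz α β : ℂ → ℂ), 0 < ε₁ ∧ ε₁ ≤ ε ∧ 0 < r₁ ∧ r₁ ≤ r₂ / 2 ∧ 0 < r₂ ∧ 0 < δ ∧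
      ContDiffOn ℝ ∞ wz (ball 0 ε₁) ∧ wz 0 = 0 ∧
      (∀ a ∈ ball (0 : ℂ) ε₁, ‖wz a‖ < r₁) ∧
      (∀ a ∈ ball (0 : ℂ) ε₁, ∀ w : ℂ, ‖w‖ ≤ r₂ → V a w ∈ range G.inB) ∧
      (∀ a ∈ ball (0 : ℂ) ε₁, ∀ w : ℂ, ‖w‖ ≤ r₂ → (V a w ∉ range G.inP ↔ w = wz a)) ∧
      (∀ a ∈ ball (0 : ℂ) ε₁, ∀ z : ℂ, ‖z‖ ≤ r₂⁻¹ → U a z ∈ range G.inP) ∧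
      (∀ a ∈ ball (0 : ℂ) ε₁, DifferentiableOn ℂ (fun w => G.boxCoord (V a w)) (ball 0 r₂)) ∧
      (∀ a ∈ ball (0 : ℂ) ε₁, deriv (fun w => (G.boxCoord (V a w)).1) (wz a) ≠ 0) ∧
      (∀ a ∈ ball (0 : ℂ) ε₁, V a (wz a) = G.inBox (0, β a)) ∧
      (∀ a ∈ ball (0 : ℂ) ε₁, G.boxCoord (V a (wz a)) = (0, β a)) ∧
      ContDiffOn ℝ ∞ β (ball 0 ε₁) ∧ β 0 = b₀ ∧
      (∀ a ∈ ball (0 : ℂ) ε₁, ‖β a - G.b₀‖ < G.ρ') ∧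
      ContDiffOn ℝ ∞ α (ball b₀ δ) ∧ α b₀ = 0 ∧
      (∀ b ∈ ball b₀ δ, α b ∈ ball (0 : ℂ) ε₁ ∧ β (α b) = b) ∧
      (∀ a ∈ ball (0 : ℂ) ε₁, β a ∈ ball b₀ δ → α (β a) = a) ∧
      (∀ b ∈ ball b₀ δ, Bijective (fderiv ℝ α b)) := by
  have hn : (∞ : WithTop ℕ∞) ≠ 0 := by simp
  -- the box chart domain and the evaluation maps
  set Vf : ℂ × ℂ → G.Y := fun q => V q.1 q.2 with hVf
  set Uf : ℂ × ℂ → G.Y := fun q => U q.1 q.2 with hUf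
  have hdomo : IsOpen (ball (0 : ℂ) ε ×ˢ (univ : Set ℂ)) := isOpen_ball.prod isOpen_univ
  have h0dom : ∀ w : ℂ, ((0 : ℂ), w) ∈ ball (0 : ℂ) ε ×ˢ (univ : Set ℂ) :=
    fun w => ⟨mem_ball_self hε, mem_univ _⟩
  -- the central sphere in the box chart: `V 0 w = inBox (memberXW w)` on `‖w‖ < r`
  obtain ⟨r, hr, -, hmaps, hVeq⟩ := G.exists_memberXW_disc hu₀ hb₀ hJstd
  set r₂ : ℝ := r / 2 with hr₂
  have hr₂pos : 0 < r₂ := by positivity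
  have hr₂r : r₂ < r := by rw [hr₂]; linarith
  have hV00 : V 0 0 = G.inBox (0, b₀) := by rw [hV0, memberV_zero]
  have hV0box : ∀ w : ℂ, ‖w‖ < r → V 0 w = G.inBox (memberXW p u₀ b₀ w) ∧ memberXW p u₀ b₀ w ∈ G.box :=
    fun w hw => ⟨by rw [hV0]; exact hVeq w (mem_ball_zero_iff.2 hw), hmaps (mem_ball_zero_iff.2 hw)⟩
  have hV0dom : ∀ w : ℂ, ‖w‖ ≤ r₂ → V 0 w ∈ range G.inB := by
    intro w hw
    rw [(hV0box w (hw.trans_lt hr₂r)).1]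
    exact G.inBox_mem_range _
  have hV0P : ∀ w : ℂ, w ≠ 0 → V 0 w ∈ range G.inP := by
    intro w hw
    rw [hV0, G.memberV_of_ne_zero hw]
    exact ⟨_, rfl⟩
  have hU0P : ∀ z : ℂ, U 0 z ∈ range G.inP := fun z => by
    rw [hU0, memberU_apply]
    exact ⟨_, rfl⟩
  -- the leaves read in the box chart: `Gf (a, w) = boxCoord (V a w)` on `O`
  set O : Set (ℂ × ℂ) := (ball (0 : ℂ) ε ×ˢ (univ : Set ℂ)) ∩ Vf ⁻¹' range G.inB with hO
  have hOo : IsOpen O := hVfam.continuousOn.isOpen_inter_preimage hdomo G.isOpen_range_inB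
  have hOdom : ∀ q ∈ O, Vf q ∈ range G.inB := fun q hq => hq.2
  have h0O : ((0 : ℂ), (0 : ℂ)) ∈ O := ⟨h0dom 0, hV0dom 0 (by simp [hr₂pos.le])⟩
  set Gf : ℂ × ℂ → ℂ × ℂ := fun q => G.boxCoord (Vf q) with hGf
  have hGs : ContDiffOn ℝ ∞ Gf O :=
    contMDiffOn_iff_contDiffOn.1
      (G.contMDiffOn_boxCoord.comp (hVfam.mono inter_subset_left) fun q hq => hq.2)
  have hG0 : Gf (0, 0) = (0, b₀) := by
    change G.boxCoord (V 0 0) = (0, b₀)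
    rw [hV00, G.boxCoord_inBox (G.zero_intercept_mem_box hb₀)]
  -- `DGf (0, 0)` is injective (immersive family, box chart), hence bijective
  have hbijG : Bijective (fderiv ℝ Gf (0, 0)) := by
    have hVd : MDifferentiableAt 𝓘(ℝ, ℂ × ℂ) (𝓡 4) Vf (0, 0) :=
      (hVfam.contMDiffAt (hdomo.mem_nhds (h0dom 0))).mdifferentiableAt hn
    have hcd : MDifferentiableAt (𝓡 4) 𝓘(ℝ, ℂ × ℂ) G.boxCoord (Vf (0, 0)) :=
      (G.contMDiffOn_boxCoord.contMDiffAt (G.isOpen_range_inB.mem_nhds (hOdom _ h0O))).mdifferentiableAt hn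
    have hchain : mfderiv 𝓘(ℝ, ℂ × ℂ) 𝓘(ℝ, ℂ × ℂ) Gf (0, 0) =
        (mfderiv (𝓡 4) 𝓘(ℝ, ℂ × ℂ) G.boxCoord (Vf (0, 0))).comp
          (mfderiv 𝓘(ℝ, ℂ × ℂ) (𝓡 4) Vf (0, 0)) :=
      mfderiv_comp _ hcd hVd
    have hinjG : Injective (fderiv ℝ Gf (0, 0)) := by
      rw [← mfderiv_eq_fderiv, hchain]
      exact (G.injective_mfderiv_boxCoord (hOdom _ h0O)).comp (hinj (0, 0) (h0dom 0)).2
    exact bijective_of_injective_real hinjG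
  -- the simple zero of `x'` along `V 0`: `(Gf (0, w)).1 = capX w` near `0`, `capX' 0 = 1`
  have hc : HasDerivAt (fun w : ℂ => (Gf (0, w)).1) 1 0 := by
    refine (hu₀.hasDerivAt_capX_zero (p := p)).congr_of_eventuallyEq ?_
    filter_upwards [ball_mem_nhds (0 : ℂ) hr] with w hw
    change (G.boxCoord (V 0 w)).1 = capX p u₀ w
    obtain ⟨h1, h2⟩ := hV0box w (mem_ball_zero_iff.1 hw)
    rw [h1, G.boxCoord_inBox h2]
    rfl
  -- the flat inverse-function-theorem package
  obtain ⟨T, A, wz, α, β, hTo, h0T, hAo, hb₀A, hwzs, hwz0, hβs, hβ0, hαs, hαb₀, hβα, hαβ, hdα,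
      hGwz, hDne, ρ, hρ, huniq⟩ :=
    InterceptChart.exists_localDiffeo Gf O b₀ 1 hOo h0O hGs hG0 hbijG hc one_ne_zero
  set r₁ : ℝ := min ρ (r₂ / 2) with hr₁
  have hr₁pos : 0 < r₁ := lt_min hρ (by positivity)
  have hr₁ρ : r₁ ≤ ρ := min_le_left _ _
  have hr₁r₂ : r₁ ≤ r₂ / 2 := min_le_right _ _
  -- everything holds for `a` near `0`
  have hE1 : ∀ᶠ a in 𝓝 (0 : ℂ), a ∈ T := hTo.mem_nhds h0T
  have hE2 : ∀ᶠ a in 𝓝 (0 : ℂ), ‖wz a‖ < r₁ := by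
    have hwc : ContinuousAt wz 0 := hwzs.continuousOn.continuousAt (hTo.mem_nhds h0T)
    have h : ∀ᶠ a in 𝓝 (0 : ℂ), wz a ∈ ball (0 : ℂ) r₁ :=
      hwc.preimage_mem_nhds (by rw [hwz0]; exact ball_mem_nhds 0 hr₁pos)
    filter_upwards [h] with a ha
    exact mem_ball_zero_iff.1 ha
  have hE3 : ∀ᶠ a in 𝓝 (0 : ℂ), ∀ w ∈ closedBall (0 : ℂ) r₂, (a, w) ∈ O := by
    apply (isCompact_closedBall (0 : ℂ) r₂).eventually_forall_of_forall_eventually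
    intro w hw
    exact hOo.mem_nhds ⟨h0dom w, hV0dom w (mem_closedBall_zero_iff.1 hw)⟩
  have hE4 : ∀ᶠ a in 𝓝 (0 : ℂ), ∀ w ∈ closedBall (0 : ℂ) r₂ \ ball 0 r₁, Vf (a, w) ∈ range G.inP := by
    apply ((isCompact_closedBall (0 : ℂ) r₂).diff isOpen_ball).eventually_forall_of_forall_eventually
    intro w hw
    have hw0 : w ≠ 0 := by
      rintro rfl
      exact hw.2 (mem_ball_self hr₁pos)
    have hcont : ContinuousAt Vf (0, w) := hVfam.continuousOn.continuousAt (hdomo.mem_nhds (h0dom w))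
    exact hcont.preimage_mem_nhds (G.isOpen_range_inP.mem_nhds (hV0P w hw0))
  have hE5 : ∀ᶠ a in 𝓝 (0 : ℂ), ∀ z ∈ closedBall (0 : ℂ) r₂⁻¹, Uf (a, z) ∈ range G.inP := by
    apply (isCompact_closedBall (0 : ℂ) r₂⁻¹).eventually_forall_of_forall_eventually
    intro z _
    have hcont : ContinuousAt Uf (0, z) := hUfam.continuousOn.continuousAt (hdomo.mem_nhds (h0dom z))
    exact hcont.preimage_mem_nhds (G.isOpen_range_inP.mem_nhds (hU0P z))
  have hE6 : ∀ᶠ a in 𝓝 (0 : ℂ), a ∈ ball (0 : ℂ) ε := ball_mem_nhds 0 hε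
  have hE7 : ∀ᶠ a in 𝓝 (0 : ℂ), ‖β a - G.b₀‖ < G.ρ' := by
    have hβc : ContinuousAt β 0 := hβs.continuousOn.continuousAt (hTo.mem_nhds h0T)
    have h : Tendsto (fun a => ‖β a - G.b₀‖) (𝓝 0) (𝓝 ‖b₀ - G.b₀‖) := by
      rw [← hβ0]; exact (hβc.sub_const _).norm
    exact h.eventually (gt_mem_nhds hb₀)
  obtain ⟨ε₀, hε₀, hall⟩ := Metric.eventually_nhds_iff.1
    (hE1.and (hE2.and (hE3.and (hE4.and (hE5.and (hE6.and (hE7.and (hDne.and huniq))))))))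
  set ε₁ : ℝ := min ε₀ ε with hε₁
  have hε₁pos : 0 < ε₁ := lt_min hε₀ hε
  have key : ∀ a ∈ ball (0 : ℂ) ε₁, a ∈ T ∧ ‖wz a‖ < r₁ ∧
      (∀ w ∈ closedBall (0 : ℂ) r₂, (a, w) ∈ O) ∧
      (∀ w ∈ closedBall (0 : ℂ) r₂ \ ball 0 r₁, Vf (a, w) ∈ range G.inP) ∧
      (∀ z ∈ closedBall (0 : ℂ) r₂⁻¹, Uf (a, z) ∈ range G.inP) ∧ a ∈ ball (0 : ℂ) ε ∧
      ‖β a - G.b₀‖ < G.ρ' ∧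
      fderiv ℝ (fun w : ℂ => (Gf (a, w)).1) (wz a) 1 ≠ 0 ∧
      (∀ w : ℂ, ‖w‖ < ρ → (a, w) ∈ O ∧ ((Gf (a, w)).1 = 0 → w = wz a)) :=
    fun a ha => hall ((mem_ball.1 ha).trans_le (min_le_left _ _))
  -- the leaf `a` meets `E` at `w = wz a`, at the point `inBox (0, β a)`
  have hhit : ∀ a ∈ ball (0 : ℂ) ε₁,
      V a (wz a) = G.inBox (0, β a) ∧ G.boxCoord (V a (wz a)) = (0, β a) := by
    intro a ha
    obtain ⟨hO', hG'⟩ := hGwz a (key a ha).1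
    have hyB : V a (wz a) ∈ range G.inB := hOdom _ hO'
    change G.boxCoord (V a (wz a)) = (0, β a) at hG'
    refine ⟨?_, hG'⟩
    rw [← G.inBox_boxCoord hyB, hG']
  -- `δ`: `α` maps `ball b₀ δ` into `ball 0 ε₁`
  have hαc : ContinuousAt α b₀ := hαs.continuousOn.continuousAt (hAo.mem_nhds hb₀A)
  obtain ⟨δ, hδ, hδsub⟩ : ∃ δ > 0, ball b₀ δ ⊆ A ∩ α ⁻¹' ball (0 : ℂ) ε₁ :=
    Metric.mem_nhds_iff.1 (inter_mem (hAo.mem_nhds hb₀A)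
      (hαc.preimage_mem_nhds (by rw [hαb₀]; exact ball_mem_nhds 0 hε₁pos)))
  -- holomorphy in the box chart
  have hholo : ∀ a ∈ ball (0 : ℂ) ε₁, DifferentiableOn ℂ (fun w => G.boxCoord (V a w)) (ball 0 r₂) := by
    intro a ha
    obtain ⟨-, -, hO', -, -, haε, -⟩ := key a ha
    have haε' : ‖a‖ < ε := mem_ball_zero_iff.1 haε
    have hVa : ContMDiffOn 𝓘(ℝ, ℂ) (𝓡 4) ∞ (V a) (ball (0 : ℂ) r₂) := by
      have h : ContMDiffOn 𝓘(ℝ, ℂ) (𝓡 4) ∞ (Vf ∘ fun w : ℂ => (a, w)) univ :=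
        hVfam.comp (contMDiff_iff_contDiff.2 (contDiff_prodMk_right a)).contMDiffOn
          fun w _ => ⟨haε, mem_univ _⟩
      exact (contMDiffOn_univ.1 h).contMDiffOn
    exact G.differentiableOn_boxCoord_comp J hJstd isOpen_ball hVa (hUV a haε').2.2
      fun w hw => hOdom _ (hO' w (mem_closedBall_zero_iff.2 (mem_ball_zero_iff.1 hw).le))
  refine ⟨ε₁, r₁, r₂, δ, wz, α, β, hε₁pos, min_le_right _ _, hr₁pos, hr₁r₂, hr₂pos, hδ,
    hwzs.mono fun a ha => (key a ha).1, hwz0, fun a ha => (key a ha).2.1, ?_, ?_, ?_, hholo, ?_,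
    fun a ha => (hhit a ha).1, fun a ha => (hhit a ha).2, hβs.mono fun a ha => (key a ha).1, hβ0,
    fun a ha => (key a ha).2.2.2.2.2.2.1,
    hαs.mono fun b hb => (hδsub hb).1, hαb₀,
    fun b hb => ⟨(hδsub hb).2, (hβα b (hδsub hb).1).2⟩,
    fun a ha _ => (hαβ a (key a ha).1).2, fun b hb => hdα b (hδsub hb).1⟩
  · -- the `V`-disc `‖w‖ ≤ r₂` lies in the box chart domain
    intro a ha w hw
    exact hOdom _ ((key a ha).2.2.1 w (mem_closedBall_zero_iff.2 hw))
  · -- the leaf meets `E` on `‖w‖ ≤ r₂` exactly at `w = wz a`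
    intro a ha w hw
    obtain ⟨-, -, hO', hP', -, -, -, -, hun⟩ := key a ha
    refine ⟨fun hnot => ?_, ?_⟩
    · by_cases hwr : ‖w‖ < r₁
      · obtain ⟨-, himp⟩ := hun w (hwr.trans_le hr₁ρ)
        apply himp
        have hyB : V a w ∈ range G.inB := hOdom _ (hO' w (mem_closedBall_zero_iff.2 hw))
        obtain ⟨b, hb1, hb2⟩ := G.exists_eq_inB_of_notMem_range_inP hnot
        change (G.boxCoord (V a w)).1 = 0
        rw [← hb2, G.boxCoord_inB, hb1]
      · exact absurd (hP' w ⟨mem_closedBall_zero_iff.2 hw, fun h => hwr (mem_ball_zero_iff.1 h)⟩) hnot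
    · rintro rfl
      rw [(hhit a ha).1, G.inBox_of_mem (G.zero_intercept_mem_box (key a ha).2.2.2.2.2.2.1)]
      exact G.inB_notMem_range_inP rfl
  · -- the `U`-disc `‖z‖ ≤ r₂⁻¹` stays in `inP (M ∖ p)`
    intro a ha z hz
    exact (key a ha).2.2.2.2.1 z (mem_closedBall_zero_iff.2 hz)
  · -- the zero `wz a` of `x'` is simple
    intro a ha hzero
    obtain ⟨-, hwzr, -, -, -, -, -, hD', -⟩ := key a ha
    apply hD'
    change fderiv ℝ (fun w => (G.boxCoord (V a w)).1) (wz a) 1 = 0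
    have hwz2 : wz a ∈ ball (0 : ℂ) r₂ :=
      mem_ball_zero_iff.2 (hwzr.trans_le (hr₁r₂.trans (by linarith)))
    have htd : DifferentiableAt ℂ (fun w => (G.boxCoord (V a w)).1) (wz a) :=
      ((hholo a ha _ hwz2).differentiableAt (isOpen_ball.mem_nhds hwz2)).fst
    rw [htd.fderiv_restrictScalars ℝ, ContinuousLinearMap.coe_restrictScalars', fderiv_apply_one_eq_deriv,
      hzero]

end PencilEnd

end Literature.Geometry.Symplectic
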